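import Summits.QuantumFields.YangMills.Theorems.VirialFluxGapSharpTwistedLaplaceQuantitativeLaplaceOrbit
import Summits.QuantumFields.YangMills.Theorems.VirialFluxGapDeficitForm
import HarnessLib

/-!
# From per-class TUBE laws to the ORBIT LAPLACE LAW of the twisted ring deficit (the interface between layers B and D)
# (DIRECT Laplace road to ⟨stmt-QuantumFields-24204⟩ `VirialFluxGap.SharpTwistedLaplace`)

Helper module (free-hands work of width seat ym-line-sfw-p2-w3 g56, cell ym-idea-1; `--supports 24204`).  The chart layer (B2/B3) delivers,
for each sign class `s` of twist-eaters, a measurable tube `T_s` of ring histories and the per-tube law of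
✓`QuantitativeLaplace.laplaceMethod_quantitative_orbit_tube`, `|∫_{T_s} e^{−βF_z} dμ_L − c_s β^{−9L⁴}| ≤ (K/β)·c_s β^{−9L⁴}`; the tubes are
pairwise disjoint (✓`ringDist_ge_of_invariants_ne`) and cover the small-deficit region `{F_z < η₀}` (✓`ringDeficit_floor_off_tube` +
✓`exists_gauge_ringDist_reference_lt` + B2's local surjectivity).  THIS FILE turns exactly these data into the per-`(L, z, β)` inequality

  ★★ `abs_integral_exp_sub_main_le_of_tubes`:  `|∫ e^{−βF_z} dμ_L − (Σ_s c_s)·β^{−9L⁴}| ≤ (K/β)·(Σ_s c_s)·β^{−9L⁴} + e^{−βη₀}`,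

i.e. the hypothesis shape of ✓`OrbitAssembly.sharpTwistedLaplace_of_orbitLaplaceLaw` (layer D) with `M = Σ_s c_s`, by one call of
✓`QuantitativeLaplace.laplaceMethod_quantitative_sum_of_tubes` on the probability space `(ring histories, ringMeasure L)` with the integrand
`e^{−βF_z}` (bounded by `e^{−βη₀}` off the tubes since `F_z ≥ η₀` there).  Also `log_sum_ge_of_forall` — the one-sided bound `log(Σ c_s) ≥ −B`
from `log c_{s₀} ≥ −B` for one class (the only size information layer D needs about `M`).

Everything here is PROVED; no definitions, no named facts (namespace `Summit.QuantumFields.YangMills.Theorems.VirialFluxGap.OrbitAssembly`).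
HONEST FRAMING: measure-theoretic plumbing; ⟨24204⟩, ⟨24319⟩ and every rung stay OPEN; the Yang–Mills mass gap (Clay) is NOT touched; no
summit is proved by a line.

## References
* K. W. Breitung, *Asymptotic Approximations for Probability Integrals*, LNM 1592 (1994), Thm 56 (6.31) (contributions of several minima add). [Breitung1994]
* E. Hasenpflug, D. Rudolf, B. Sprungk, Ann. Appl. Probab. 34 (2024), §3.4. [HasenpflugRudolfSprungk2024]
-/

set_option autoImplicit false

noncomputable section

open MeasureTheory Set
open scoped BigOperators
open Literature.MathematicalPhysics.QuantumFieldTheory hiding SU2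
open Summit.QuantumFields.YangMills.Theorems.FemtoTransferGap
open Summit.QuantumFields.YangMills.Theorems.VirialFluxGap.RingDeficit
open Summit.QuantumFields.YangMills.Theorems.QuantitativeLaplace

namespace Summit.QuantumFields.YangMills.Theorems.VirialFluxGap.OrbitAssembly

variable {L : ℕ} [NeZero L]

/-- ★★ **Per-class tube laws ⇒ the orbit Laplace law of the ring deficit.**  For a finite family of pairwise disjoint measurable tubes `T_s` of
ring histories covering `{F_z < η₀}`, per-tube laws `|∫_{T_s} e^{−βF_z} dμ_L − c_s β^{−9L⁴}| ≤ (K/β)·c_s β^{−9L⁴}` (`β > 0`):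
`|∫ e^{−βF_z} dμ_L − (Σ_s c_s) β^{−9L⁴}| ≤ (K/β)·(Σ_s c_s) β^{−9L⁴} + e^{−βη₀}`. [cite: Breitung1994, Thm 56 (6.31)] -/
theorem abs_integral_exp_sub_main_le_of_tubes {ι : Type*} [Fintype ι] (z : Fin 3 → Bool)
    {T : ι → Set ((Fin (2 * L - 1 + 1) → GaugeConfig 3 L SU2) × (Site 3 L → SU2))}
    (hTm : ∀ s, MeasurableSet (T s)) (hdisj : Pairwise fun s s' => Disjoint (T s) (T s'))
    {β η₀ K : ℝ} (hβ : 0 < β) {c : ι → ℝ}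
    (hcover : ∀ P, ringDeficit L z P < η₀ → P ∈ ⋃ s, T s)
    (hlaw : ∀ s, |(∫ P in T s, Real.exp (-(β * ringDeficit L z P)) ∂(ringMeasure L)) - c s * β ^ (-(9 * (L : ℝ) ^ 4))| ≤
        K / β * (c s * β ^ (-(9 * (L : ℝ) ^ 4)))) :
    |(∫ P, Real.exp (-(β * ringDeficit L z P)) ∂(ringMeasure L)) - (∑ s, c s) * β ^ (-(9 * (L : ℝ) ^ 4))| ≤
      K / β * ((∑ s, c s) * β ^ (-(9 * (L : ℝ) ^ 4))) + Real.exp (-(β * η₀)) := by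
  haveI := isProbabilityMeasure_ringMeasure (L := L)
  have hFm : Measurable fun P : (Fin (2 * L - 1 + 1) → GaugeConfig 3 L SU2) × (Site 3 L → SU2) =>
      Real.exp (-(β * ringDeficit L z P)) := (measurable_const.mul (measurable_ringDeficit z)).neg.exp
  have hFi : ∀ s, IntegrableOn (fun P => Real.exp (-(β * ringDeficit L z P))) (T s) (ringMeasure L) :=
    fun s => (integrable_exp_neg_mul_ringDeficit β z).integrableOn
  -- off the tubes `F_z ≥ η₀`, so the integrand is at most `e^{−βη₀}`
  have hout : ∀ P, P ∉ (⋃ s, T s) → |Real.exp (-(β * ringDeficit L z P))| ≤ Real.exp (-(β * η₀)) := by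
    intro P hP
    have hge : η₀ ≤ ringDeficit L z P := by
      by_contra hlt
      exact hP (hcover P (lt_of_not_ge hlt))
    rw [abs_of_pos (Real.exp_pos _), Real.exp_le_exp]
    nlinarith
  have h := laplaceMethod_quantitative_sum_of_tubes (ρ := ringMeasure L) hTm hdisj hFm hFi
    (ℓ := fun s => c s * β ^ (-(9 * (L : ℝ) ^ 4))) (ε := fun s => K / β * (c s * β ^ (-(9 * (L : ℝ) ^ 4)))) hlaw
    (Real.exp_pos _).le hout
  have hsumℓ : (∑ s, c s * β ^ (-(9 * (L : ℝ) ^ 4))) = (∑ s, c s) * β ^ (-(9 * (L : ℝ) ^ 4)) := by rw [Finset.sum_mul]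
  have hsumε : (∑ s, K / β * (c s * β ^ (-(9 * (L : ℝ) ^ 4)))) = K / β * ((∑ s, c s) * β ^ (-(9 * (L : ℝ) ^ 4))) := by
    rw [← Finset.mul_sum, Finset.sum_mul]
  rw [hsumℓ, hsumε, probReal_univ, mul_one] at h
  exact h

/-- The one-sided size bound layer D needs: if one class has `log c_{s₀} ≥ −B` and all `c_s ≥ 0`, then `log(Σ_s c_s) ≥ −B`. [folklore] -/
theorem log_sum_ge_of_forall {ι : Type*} [Fintype ι] {c : ι → ℝ} (hc : ∀ s, 0 ≤ c s) (s₀ : ι) (hc₀ : 0 < c s₀) {B : ℝ}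
    (hB : -B ≤ Real.log (c s₀)) : -B ≤ Real.log (∑ s, c s) := by
  have hle : c s₀ ≤ ∑ s, c s := Finset.single_le_sum (fun s _ => hc s) (Finset.mem_univ s₀)
  exact hB.trans (Real.log_le_log hc₀ hle)

/-- Positivity of the main coefficient from one class. [folklore] -/
theorem sum_pos_of_exists {ι : Type*} [Fintype ι] {c : ι → ℝ} (hc : ∀ s, 0 ≤ c s) (s₀ : ι) (hc₀ : 0 < c s₀) : 0 < ∑ s, c s :=
  lt_of_lt_of_le hc₀ (Finset.single_le_sum (fun s _ => hc s) (Finset.mem_univ s₀))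

end Summit.QuantumFields.YangMills.Theorems.VirialFluxGap.OrbitAssembly

end
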